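import Summits.BirchSwinnertonDyer.Rank1Residual.P2.CongruentNumberOddFiveThreeModEightMonskyDescent
import Literature.NumberTheory.EllipticCurves.Tian2014.CMPointSystemDescentPrimeBase
import HarnessLib

/-!
# Cell «bsd-monsky» (prover-A, g13): ROUTE A AT ONE PRIME — `N = 2p`, `p ≡ 3 (mod 8)` (Monsky's `2p₃`, Cor. 5.15 (1)),
# from Tian's printed CM-point system alone: Tian Prop. 4.6 = Monsky Thm. 4.5 for Tian's point `2y_{2p}`;
# rank `E_{2p}(ℚ) = 1`, `2p` congruent, `Ш(E_{2p})[2^∞] = 0`, odd index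

HONEST FRAMING (cell `bsd-monsky`, run/shared/lean/pub/bsd-monsky/, README §1: ONE theorem on ONE explicit infinite
family at the prime `2`; nothing booked). This file asserts NO arithmetic fact and claims NOTHING new on paper: that
`2p` is a congruent number for every prime `p ≡ 3 (mod 8)` is classical (Heegner 1952 / Birch 1968 / Stephens 1975;
Monsky 1990 Thm. 4.5 and Cor. 5.15 (1) «`2p₃`»; Tian 2014 Prop. 4.6, "proved in [19] (Monsky), we repeat its proof
here for completeness"). The cell's route A transplanted Monsky's TWO-PRIME descent (Thm. 5.5 / 5.9, the `k = 1` step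
of Tian's induction) onto Tian's points; this file transplants the ONE-PRIME BASE CASE (Tian Thm. 4.5: "`k = 0` is
given by Proposition 4.6"), and records the consequences from the PRINTED SYSTEM BINDER alone —
`hSk₁ : ∀ p ≡ 3 (8) prime, ∃ D : CMPointData p, D.Printed ∧ ∀ s : D.H, s² = 2 → σ_{1+ϖ}(s) = s`
(Tian 2014 Thm. 2.8 (1)–(3), (4.8), the Galois facts of §2 / §4.2 / Prop. 4.6 — the displays of
`CMPointSystemDisplays` — plus the ONE printed sentence "`σ_{1+ϖ}` moves `i` but fixes `√2`", p0024 L1; binder form,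
no new named fact; no Gross–Zagier display, no `2`-Selmer display, no genus display — "`φ` has odd cardinality" is a
KERNEL THEOREM of Gauss + Rédei–Reichardt in the tree):
* (M-2y) for EVERY transversal `φ` of `𝒜/[ϖ′]` a RATIONAL point `y″ ∈ E_{2p}(ℚ)` with `transfer y″ = 2y_{2p,φ}` and
  `y″ ∉ 2E_{2p}(ℚ) + E_{2p}(ℚ)_tor` (`Tian2014.CMPointData.exists_transfer_eq_two_nsmul_yPoint_not_two_smul_add_torsion_prime_three_mod_eight`);
* rank `E_{2p}(ℚ) = 1` (`y″` non-torsion; `≤ 1` = «`S̄ = ℤ/2`» on the Cor. 5.15 family `2p₃`, the tree's exact count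
  `#Sel₂(E_{2p}) = 8`, p528474); `2p` is a congruent number; `Ш(E_{2p})[2^∞] = 0`; `y″` has ODD INDEX against every
  generator of `E_{2p}(ℚ)/tor`.
In the tree the family `2p₃` was so far reached through «`Σ₂′` odd» and DOOR B6 (relative to {`U⁺`, GZK}; g11's
`CongruentNumberCor515Displays`); this is a second, Gross–Zagier-free proof of rank one there, by Monsky's own route on
Tian's points. Nothing is asserted unconditionally beyond the tree's own descent theorems.
[cite: Tian2014, Prop. 4.6 (arXiv:1210.8231 p0023 L15–L22) and its proof (p0023 L26–p0024 L5), Thm. 4.5 (p0023 L8–L14)]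
[cite: Monsky1990MockHeegner, Thm. 4.5 (p. 57), Cor. 5.15 (1) (p. 66), Remark (2) (p. 67)]
[cite: SilvermanAEC2009, Thm. X.4.2, Thm. VIII.6.7] [cite: TopYui2008Congruent, Prop. 3.3 (i) ⟺ (iv)]
-/

noncomputable section

open scoped Classical NumberTheorySymbols

open WeierstrassCurve NumberField Literature.NumberTheory.EllipticCurves
  Literature.NumberTheory.EllipticCurves.Rank1Residual
  Literature.NumberTheory.EllipticCurves.Rank1Residual.Typed
  Literature.NumberTheory.EllipticCurves.Monsky1990
  Literature.NumberTheory.EllipticCurves.TianYuanZhang2017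

set_option autoImplicit false

namespace Summit.BirchSwinnertonDyer.Rank1Residual.P2

open Conjectures Literature.NumberTheory.EllipticCurves.Tian2014

/-! ## §1 The family `2p₃` is a Cor. 5.15 family -/

/-- **`2p` with `p ≡ 3 (8)` prime is Monsky's family `2p₃` of Cor. 5.15 (1)**.
[cite: Monsky1990MockHeegner, Cor. 5.15 (1) (p. 66)] -/
theorem isCor515Family_two_mul_three_mod_eight {p : ℕ} (hp : p.Prime) (hp8 : p % 8 = 3) :
    IsCor515Family (2 * p) :=
  Or.inr (Or.inl ⟨p, hp, Or.inl hp8, rfl⟩)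

/-! ## §2 Rank one, congruent, `Ш[2^∞] = 0` and the odd index on `2p₃` from the printed system binder -/

/-- **Rank `E_{2p}(ℚ) = 1` for every prime `p ≡ 3 (mod 8)` from the printed system binder alone** (Tian Prop. 4.6 =
Monsky Thm. 4.5 transplanted: `2y_{2p}` is the transfer of a rational point `y″ ∉ 2E + tor`, so `rank ≥ 1`; `rank ≤ 1`
is the tree's exact count `#Sel₂(E_{2p}) = 8` on the Cor. 5.15 family `2p₃`). No Gross–Zagier input.
[cite: Tian2014, Prop. 4.6 (p0023 L15–L22)] [cite: Monsky1990MockHeegner, Thm. 4.5 (p. 57), Cor. 5.15 (1) (p. 66)]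
[cite: SilvermanAEC2009, Thm. X.4.2] -/
theorem mordellWeilRank_eq_one_two_mul_three_mod_eight_of_printed
    (hSk₁ : ∀ p : ℕ, p.Prime → p % 8 = 3 →
      ∃ D : CMPointData p, D.Printed ∧ ∀ s : D.H, s ^ 2 = 2 → D.tau s = s) :
    ∀ p : ℕ, p.Prime → p % 8 = 3 → (congruentNumberCurve (2 * p)).mordellWeilRank = 1 := by
  intro p hp hp8
  have hN : IsCor515Family (2 * p) := isCor515Family_two_mul_three_mod_eight hp hp8
  haveI := isElliptic_congruentNumberCurve hN.ne_zero
  obtain ⟨D, hP, hτ2⟩ := hSk₁ p hp hp8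
  obtain ⟨⟨φ, hφ⟩, hall⟩ :=
    D.exists_transfer_eq_two_nsmul_yPoint_not_two_smul_add_torsion_prime_three_mod_eight hp hp8 hP hτ2
  obtain ⟨y'', -, hnot⟩ := hall φ hφ
  exact le_antisymm (mordellWeilRank_le_one_of_isCor515Family hN)
    (Nat.one_le_iff_ne_zero.mpr (mordellWeilRank_ne_zero_of_not_two_smul_add_torsion hN.ne_zero y'' hnot))

/-- **`2p` is a congruent number for every prime `p ≡ 3 (mod 8)` from the printed system binder alone** (Cor. 5.15 (1)
«`2p₃`»; "In particular, `2y_m ∈ E(ℚ(√−m))⁻` is of infinite order and therefore `m` is a congruent number").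
[cite: Tian2014, Prop. 4.6 (p0023 L20–L22)] [cite: Monsky1990MockHeegner, Cor. 5.15 (1) (p. 66)]
[cite: TopYui2008Congruent, Prop. 3.3 (i) ⟺ (iv)] -/
theorem isCongruentNumber_two_mul_three_mod_eight_of_printed
    (hSk₁ : ∀ p : ℕ, p.Prime → p % 8 = 3 →
      ∃ D : CMPointData p, D.Printed ∧ ∀ s : D.H, s ^ 2 = 2 → D.tau s = s) :
    ∀ p : ℕ, p.Prime → p % 8 = 3 → IsCongruentNumber (2 * p) :=
  fun p hp hp8 =>
    (Wiles2000.mordellWeilRank_ne_zero_iff_isCongruentNumber (by have := hp.pos; omega)).mp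
      (by rw [mordellWeilRank_eq_one_two_mul_three_mod_eight_of_printed hSk₁ p hp hp8]; exact one_ne_zero)

/-- **`Ш(E_{2p})[2^∞] = 0` for every prime `p ≡ 3 (mod 8)` from the printed system binder alone** (rank one and the exact
count `#Sel₂(E_{2p}) = 8`). [cite: Monsky1990MockHeegner, Remark (2) (p. 67)] [cite: SilvermanAEC2009, Thm. X.4.2] -/
theorem primaryComponent_sha_two_eq_bot_two_mul_three_mod_eight_of_printed
    (hSk₁ : ∀ p : ℕ, p.Prime → p % 8 = 3 →
      ∃ D : CMPointData p, D.Printed ∧ ∀ s : D.H, s ^ 2 = 2 → D.tau s = s) :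
    ∀ p : ℕ, (hp : p.Prime) → p % 8 = 3 →
      haveI := isElliptic_congruentNumberCurve (n := 2 * p) (Nat.mul_ne_zero two_ne_zero hp.ne_zero)
      AddCommGroup.primaryComponent (congruentNumberCurve (2 * p)).sha 2 = ⊥ := by
  intro p hp hp8
  have hN : IsCor515Family (2 * p) := isCor515Family_two_mul_three_mod_eight hp hp8
  have h := (isCongruentNumber_iff_primaryComponent_sha_two_eq_bot_of_isCor515Family hN).mp
    (isCongruentNumber_two_mul_three_mod_eight_of_printed hSk₁ p hp hp8)
  convert h

/-- **MONSKY'S THEOREM 4.5 FOR TIAN'S POINT `2y_{2p}`, `p ≡ 3 (mod 8)`, from the printed system binder alone**: for every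
such `p` and printed system `D` there is a transversal `φ` of `𝒜/[ϖ′]`, and for EVERY transversal a rational point
`y″ ∈ E_{2p}(ℚ)` with `transfer y″ = 2y_{2p,φ}`, of INFINITE ORDER and ODD INDEX against every generator of
`E_{2p}(ℚ)/tor` ("`2y_m ∈ E(ℚ(√−m))⁻ ∖ (2E(ℚ(√−m))⁻ + E[2])`"). No `L`-function, no Gross–Zagier display, no `2`-Selmer
display, no reading mark. [cite: Tian2014, Prop. 4.6 (p0023 L15–L22)] [cite: Monsky1990MockHeegner, Thm. 4.5 (p. 57)] -/
theorem monskyOddIndex_two_mul_three_mod_eight_of_printed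
    (hSk₁ : ∀ p : ℕ, p.Prime → p % 8 = 3 →
      ∃ D : CMPointData p, D.Printed ∧ ∀ s : D.H, s ^ 2 = 2 → D.tau s = s) :
    ∀ p : ℕ, (hp : p.Prime) → p % 8 = 3 →
      ∃ D : CMPointData p, D.Printed ∧ (∀ s : D.H, s ^ 2 = 2 → D.tau s = s) ∧
        (∃ φ, D.IsRepsModPiPrime φ) ∧
        ∀ φ : Finset (ClassGroup (𝓞 (GenusField (2 * p)))), D.IsRepsModPiPrime φ →
          ∃ y'' : (congruentNumberCurve (2 * p)).toAffine.Point,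
            D.transfer hp.ne_zero y'' = (2 : ℕ) • D.yPoint φ ∧ ¬ IsOfFinAddOrder y'' ∧
            (∀ g : (congruentNumberCurve (2 * p)).toAffine.Point, GeneratesFreePartRat (2 * p) g →
              ∃ m : ℤ, Odd m ∧ IsOfFinAddOrder (y'' - m • g)) := by
  intro p hp hp8
  obtain ⟨D, hP, hτ2⟩ := hSk₁ p hp hp8
  obtain ⟨hex, hall⟩ :=
    D.exists_transfer_eq_two_nsmul_yPoint_not_two_smul_add_torsion_prime_three_mod_eight hp hp8 hP hτ2
  refine ⟨D, hP, hτ2, hex, fun φ hφ => ?_⟩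
  obtain ⟨y'', hy'', hnot⟩ := hall φ hφ
  exact ⟨y'', hy'', not_isOfFinAddOrder_of_not_two_smul_add_torsion y'' hnot,
    fun g hg => exists_odd_isOfFinAddOrder_sub_zsmul_of_not_two_smul_add_torsion y'' hnot g hg⟩

/-- **Monsky's Theorem 4.5 (`2p₃`) and Theorem 5.5 (`p₅q₃`, both twists) from their respective printed binders**: the
one-prime base case and the two-prime step of the same induction, for Tian's points — rank one and congruent on
`2p₃`, `p₅q₃` and `2p₅q₃`. [cite: Tian2014, Thm. 4.5 (p0023 L8–L14: "k = 0 is given by Proposition 4.6")]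
[cite: Monsky1990MockHeegner, Thm. 4.5 (p. 57), Thm. 5.5 (p. 62), Cor. 5.15 (1)(2) (p. 66)] -/
theorem monsky_thm45_thm55_of_printed_of_skeleton
    (hSk₁ : ∀ p : ℕ, p.Prime → p % 8 = 3 →
      ∃ D : CMPointData p, D.Printed ∧ ∀ s : D.H, s ^ 2 = 2 → D.tau s = s)
    (hSk : ∀ p q : ℕ, (hp : p.Prime) → (hq : q.Prime) → p % 8 = 5 → q % 8 = 3 →
      ∃ D : CMPointData (p * q), D.PrintedCore ∧ D.GenusTheoryDisplaysCore) :
    (∀ p : ℕ, p.Prime → p % 8 = 3 →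
      (congruentNumberCurve (2 * p)).mordellWeilRank = 1 ∧ IsCongruentNumber (2 * p)) ∧
    ∀ p q : ℕ, p.Prime → q.Prime → p % 8 = 5 → q % 8 = 3 →
      ((congruentNumberCurve (p * q)).mordellWeilRank = 1 ∧ IsCongruentNumber (p * q)) ∧
      ((congruentNumberCurve (2 * (p * q))).mordellWeilRank = 1 ∧ IsCongruentNumber (2 * (p * q))) :=
  ⟨fun p hp hp8 => ⟨mordellWeilRank_eq_one_two_mul_three_mod_eight_of_printed hSk₁ p hp hp8,
      isCongruentNumber_two_mul_three_mod_eight_of_printed hSk₁ p hp hp8⟩,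
    monsky_thm55_both_twists_of_skeleton hSk⟩

end Summit.BirchSwinnertonDyer.Rank1Residual.P2

end
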